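import Mathlib
import HarnessLib
import Summits.Parity.GeneralizedHardyLittlewood.Theses.LeeYangFibres
import Summits.Parity.GeneralizedHardyLittlewood.Theorems.LeeYangFibresFibreHyperbolicityDefs
import Summits.Parity.GeneralizedHardyLittlewood.Theorems.LeeYangFibresAbsoluteUpgradeDefs

/-!
# Route `LeeYangFibres`, crux `AbsoluteUpgrade` (stmt-Parity-14116): vocabulary of the line `dip-margin-rate-exchange`

Route-posited objects and STATEMENTS (D-0016 `<Route><Crux>Defs` file) shared by the registered stubs of the
skeleton `Cruxes/AbsoluteUpgrade/Lines/dip_margin_rate_exchange.lean` (crux-plan `dip-margin-rate-exchange`, as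
RESHAPED by the line lead seat c1, `prover-line-stmt-Parity-14116-c1-0`, 2026-08-16) and by the files that prove
and compose them.  Nothing is asserted: every `def … : Prop` below is a statement (the TYPE of a registered stub,
or of a hypothesis of one), consumed only as such; the two theorems (`four_le_slowDegree`,
`primeCellsAbsolute_iff`) are proved.

The line (one paragraph).  The residual of the route is EXACTLY the factor `sup_Ψ ∏_p β_p ≍ (log log N)^{t-1}`
(tree: `Theorems.AbsoluteUpgrade.stub_singularProduct_le_loglog_pow`, p86331; sharp by
`exists_pair_singularProduct_ge_loglog`, p90245).  Full real-rootedness of a fibre of the joint rough-cell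
polynomial, read through the MODEL PENCIL `F_u(ζ) + θ F_u(-ζ)` of the Buchstab–Dickman row
`F_u = Σ_{j<u} I_{j+1}(u) ζ^j` (`cellDensity`), clips the odd Walsh amplitude of that fibre below the pencil's
real-rootedness threshold; along the ROUGHNESS SCHEDULE `u = U(N) := max 4 ⌊√(log log N)/2⌋` (`slowDegree`) a
threshold below every power `U^{-m}` (`MarginPoly`, the line's one new parity-free theorem) beats
`(log log N)^{t-1} ≤ (2U+2)^{2t-2}`, so the prime cell comes out with ABSOLUTE error `ε N/log^t N`
(`PrimeCellsAbsolute`, the node shared with the sibling line `nlc-cells-absolute-clip` and imported from its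
vocabulary file), and partial summation with the landed singular-product bound gives `DimOne`.

RESHAPE relative to the planner's skeleton (lead seat c1, cycle 1; composition unchanged): (1) the schedule is
`√(log log N)/2` instead of `(log₃ N)²` — then `(log log N)^{t-1}` is a POWER of `U`, so (2) the margin statement
only needs the threshold to decay faster than every power of `u` (`MarginPoly`, `∀ m`) instead of exponentially
(`MarginExp`, kept below for the record: it implies `MarginPoly`), with POLYNOMIAL relative robustness `u^{-m-4}`
plus an absolute floor `u^{-u}` that also frees the law-small top cell; this is the form the mod-Gamma asymptotics
`F_u(z) ≈ e^{-γz}(u-1)^z/Γ(1+z)` (zeros of the row at `-1, -2, …`, lobe ratios `≍ u^{-2k-1}`) can deliver;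
(3) `PrimeCellsAbsolute` is the sibling line's declaration (the two lines' cells `ModelTransfer.jointCell` /
`Negative.cell` and `NlcCellsAbsoluteClip.jointCell` / `roughCell` agree definitionally: `primeCellsAbsolute_iff`).
Law-visibility of every cell along the new schedule: `(log N)^{-δ} = e^{-4δU²(1+o(1))} ≪ U^{-U}`; anatomy to relative
`e^{-U²} = (log N)^{-1/4+o(1)}` is inside the de la Vallée Poussin rate.

Objects: `slowDegree`.  Statements: `FibreHyperbolicityAlong`, `CellParityLawSaving` (the two conjectural,
`RelativeDimOne`-guarded inputs: `u`-uniform clauses of cruxes 2 and 3 along the schedule), `MarginPoly`,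
`MarginExp`, `AnatomyAlong` (parity-free), and the imported `NlcCellsAbsoluteClip.PrimeCellsAbsolute`.

References: Green–Tao 2010 §1 [GreenTao2010]; Alladi 1982 [Alladi1982] and Tenenbaum III.6 [Tenenbaum2015]
(Buchstab–Dickman `Ω`-cell densities); Borcea–Brändén 2009 [BorceaBranden2009] / Wagner 2011 §2 [Wagner2011]
(Hermite–Biehler, real-rootedness); Kowalski–Nikeghbali 2010 [KowalskiNikeghbali2010] (mod-Poisson limits with
limiting function `1/Γ`, the source of the `MarginPoly` prediction).
-/

noncomputable section

namespace Summit.Parity.GeneralizedHardyLittlewood.Cruxes.AbsoluteUpgrade.DipMarginRateExchange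

open scoped BigOperators Classical
open Literature.NumberTheory.Sieve
open Summit.Parity.GeneralizedHardyLittlewood.Theses.LeeYangFibres
open Summit.Parity.GeneralizedHardyLittlewood.Cruxes.ModelHyperbolicity.WindowChainTransport (cellDensity)
open Summit.Parity.GeneralizedHardyLittlewood.Theorems.ModelHyperbolicity.Negative (cell)
open Summit.Parity.GeneralizedHardyLittlewood.Cruxes.FibreHyperbolicity.ModelTransfer (jointCell fibre)

/-! ## The schedule -/

/-- **The roughness schedule** `U(N) = max 4 ⌊√(log log N)/2⌋`: the degree of the fibre polynomials grows with
the scale so slowly that every cell is law-visible (`(log N)^{-δ} ≪ U^{-U}`) and the anatomy is accurate to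
relative `e^{-U²}`, while the residual factor `(log log N)^{t-1} ≤ (2U+2)^{2t-2}` is a fixed power of `U`, beaten
by a threshold below every power of `U`.  Line object (lead seat c1 reshape of the planner's `(log₃ N)²`). -/
def slowDegree (N : ℕ) : ℕ := max 4 ⌊Real.sqrt (Real.log (Real.log N)) / 2⌋₊

/-- The schedule never drops below degree `4` (so `2 ≤ U(N)` wherever the route's cells need it). -/
theorem four_le_slowDegree (N : ℕ) : 4 ≤ slowDegree N := le_max_left _ _

/-! ## Statements (types of the registered stubs; nothing is asserted) -/

/-- **Fibre hyperbolicity ALONG THE SCHEDULE** (the `u`-uniform clause of crux 2): for `N ≥ N₀(t, L, η)`,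
every fibre of the joint rough-cell polynomial at roughness `u = U(N)` of every admissible `(Ψ, K)` of singular
mass `≥ ηN` has only real zeros — VERBATIM the fibre sum of `LeeYangFibres.FibreHyperbolicity`
(`ModelTransfer.fibre`) with `u := slowDegree N`.  Crux-2 strength (HL-type parity content); in the line it is
the type of the GUARDED stub `stub_fibreHyperbolicityAlong : RelativeDimOne → FibreHyperbolicityAlong`
(line statement, not a literature fact). -/
def FibreHyperbolicityAlong : Prop :=
  ∀ (t L : ℕ), 1 ≤ t → ∀ η : ℝ, 0 < η → ∃ N₀ : ℕ, ∀ N : ℕ, N₀ ≤ N →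
    ∀ Ψ : Fin t → AffLinForm 1, IsNondegenerateSystem Ψ → affLinSize Ψ N ≤ L →
    ∀ K : Set (Fin 1 → ℝ), Convex ℝ K → K ⊆ realBox 1 N →
    η * (N : ℝ) ≤ archFactor Ψ K * singularProduct Ψ →
    ∀ i : Fin t, ∀ w : Fin t → ℝ, (∀ k, 0 < w k ∧ w k ≤ 1) →
    ∀ ζ : ℂ, fibre t N (slowDegree N) Ψ K i w ζ = 0 → ζ.im = 0

/-- **The cell-parity law ALONG THE SCHEDULE WITH A LOG-POWER SAVING** (the `u`-uniform, rate-bearing clause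
of crux 3): for some `δ = δ(t, L) > 0` and `N ≥ N₀`, the joint rough cells at roughness `U(N)` of every admissible
`(Ψ, K)` are `W_θ(σ(j)) · β_∞ ∏_p β_p · ∏_i A_{j_i}(N)/N` up to `N / (log^t N · (log N)^δ)`, with Walsh amplitudes
`θ_∅ = 1`, `|θ_S| ≤ 2` — VERBATIM the body of `LeeYangFibres.CellParityLaw` (`ModelTransfer.jointCell`, model cells
`Negative.cell`) with `u := slowDegree N` and `ε ↦ (log N)^{-δ}`.  Crux-3 strength; in the line it is the type of
the GUARDED stub `stub_cellParityLawSaving : RelativeDimOne → CellParityLawSaving` (line statement, not a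
literature fact). -/
def CellParityLawSaving : Prop :=
  ∀ (t L : ℕ), 1 ≤ t → ∃ δ : ℝ, 0 < δ ∧ ∃ N₀ : ℕ, ∀ N : ℕ, N₀ ≤ N →
    ∀ Ψ : Fin t → AffLinForm 1, IsNondegenerateSystem Ψ → affLinSize Ψ N ≤ L →
    ∀ K : Set (Fin 1 → ℝ), Convex ℝ K → K ⊆ realBox 1 N →
    ∃ θ : Finset (Fin t) → ℝ, θ ∅ = 1 ∧ (∀ S, |θ S| ≤ 2) ∧
      ∀ j : Fin t → ℕ, (∀ i, 1 ≤ j i ∧ j i ≤ slowDegree N) →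
        |(jointCell t N (slowDegree N) Ψ K j : ℝ) -
            (∑ S : Finset (Fin t), θ S * ∏ i ∈ S, (-1 : ℝ) ^ (j i + 1)) *
              (archFactor Ψ K * singularProduct Ψ *
                ∏ i, (cell (slowDegree N) N (j i) : ℝ) / N)| ≤
          (N : ℝ) / (Real.log N ^ t * Real.log N ^ δ)

/-- **MARGIN-POLY — the real-rootedness threshold of the Buchstab–Dickman pencil decays faster than every
power, robustly** (parity-free, pure real analysis on the densities `I_{j+1}(u) = cellDensity j u`; the line's
one new theorem).  For every `m` there is `u₀` such that for every integer `u ≥ u₀`, every tilt `θ` with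
`u^{-m} ≤ |θ| ≤ 2`, and every NON-NEGATIVE coefficient row `b` with
`|b_j − (1 + θ(-1)^j) I_{j+1}(u)| ≤ u^{-m-4} I_{j+1}(u) + u^{-u}` for `j < u` (polynomial RELATIVE robustness
plus an absolute floor `u^{-u}` on the scale `I_1 = 1`, which also frees the law-small top coefficient
`j = u-1`, where `I_u(u) = 0`), the polynomial `Σ_{j<u} b_j z^j` has a NON-REAL zero.  (For `|θ| > 1 + o(1)`
the hypotheses are unsatisfiable — `b_0 ≥ 0` resp. `b_1 ≥ 0` against `(1+θ) I_1 < 0` resp. `(1-θ) I_2 < 0` — so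
the content is `|θ| ≤ 1`.)  Prediction behind it (lead seat c1): the Laplace transform of the delay equation
`v K_z'(v) = z K_z(v-1)` solved by `F_u(z) = K_z(u-1)` is `s⁻¹ exp(z E₁(s)) = e^{-γz} s^{-1-z} e^{z Ein(s)}`, whence
`F_u(z) = e^{-γz}(u-1)^z/Γ(1+z) · (1 + O_k(1/u))` on `|z| ≤ k + 1`: the row's zeros converge to `-1, …, -k`, the
lobe of `F_u` between `-k-1` and `-k` has height `≍ u^{-k-1/2}` against `F_u(k+½) ≍ u^{k+1/2}`, so a tilt
`|θ| ≫ u^{-2k-1}` removes that pair of real zeros (threshold `θ*(u) ≲ min_k C_k u^{-2k-1}`; numerically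
`θ*(u) ≈ e^{-0.94u}` for `u ≤ 60`, kit j000121/j013691/j013893/j013661).  Line statement (type of the registered
stub `stub_marginPoly`). -/
def MarginPoly : Prop :=
  ∀ m : ℕ, ∃ u₀ : ℕ, ∀ u : ℕ, u₀ ≤ u → ∀ θ : ℝ, ((u : ℝ) ^ m)⁻¹ ≤ |θ| → |θ| ≤ 2 →
    ∀ b : ℕ → ℝ, (∀ j : ℕ, j < u → 0 ≤ b j) →
      (∀ j : ℕ, j < u →
        |b j - (1 + θ * (-1) ^ j) * cellDensity j u| ≤
          ((u : ℝ) ^ (m + 4))⁻¹ * cellDensity j u + ((u : ℝ) ^ u)⁻¹) →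
      ∃ z : ℂ, (∑ j ∈ Finset.range u, (b j : ℂ) * z ^ j) = 0 ∧ z.im ≠ 0

/-- **MARGIN-EXP — the planner's exponential form** (kept for the record; it implies `MarginPoly` for large `u`
since its tilt range `e^{-cu} ≤ |θ|` is wider and its robustness radius `e^{-u²}` narrower): there are `c > 0` and
`u₀` such that for every integer `u ≥ u₀`, every tilt `θ` with `e^{-cu} ≤ |θ| ≤ 2`, and every non-negative row
`b` within RELATIVE distance `e^{-u²}` of the tilted row `(1 + θ(-1)^j) I_{j+1}(u)` (`j < u`; the top index
`j = u-1` is allowed a free coefficient of size `≤ e^{-u²} I_{u-1}(u)`), `Σ_{j<u} b_j z^j` has a non-real zero.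
Line statement (type of no registered stub after the seat-c1 reshape; numerics: `θ*(u) ≈ e^{-(0.92–1.0)u}`
through `u = 60`). -/
def MarginExp : Prop :=
  ∃ c : ℝ, 0 < c ∧ ∃ u₀ : ℕ, ∀ u : ℕ, u₀ ≤ u → ∀ θ : ℝ, Real.exp (-(c * u)) ≤ |θ| → |θ| ≤ 2 →
    ∀ b : ℕ → ℝ, (∀ j : ℕ, j < u → 0 ≤ b j) →
      (∀ j : ℕ, j < u →
        |b j - (1 + θ * (-1) ^ j) * cellDensity j u| ≤
          Real.exp (-((u : ℝ) ^ 2)) * (cellDensity j u + if j + 1 = u then cellDensity (u - 2) u else 0)) →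
      ∃ z : ℂ, (∑ j ∈ Finset.range u, (b j : ℂ) * z ^ j) = 0 ∧ z.im ≠ 0

/-- **Anatomy of rough integers ALONG THE SCHEDULE** (parity-free, provable now): for `N ≥ N₀` and every
`1 ≤ m < U(N)`, `A_m(N) = I_m(U(N)) · N/log N · (1 ± e^{-U(N)²}/8)` — Alladi's cell asymptotics with de la
Vallée Poussin's rate (tree pattern `WindowChainTransport.CellRate` / `stub_cellRate`: error `C(m,k) X/log² Y`),
whose constants must stay below `(log N)^{3/4 - o(1)} = exp((3 - o(1)) U²)` along the induction on `m`; here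
`e^{-U²} = (log N)^{-1/4 + o(1)}` and the smallest genuine cell is `I_{U-1}(U) ≥ 1/((U-2)!(U-1)!) = (log N)^{-o(1)}`.
Line statement (type of the registered stub `stub_anatomyAlong`); sources Alladi 1982, Tenenbaum III.6. -/
def AnatomyAlong : Prop :=
  ∃ N₀ : ℕ, ∀ N : ℕ, N₀ ≤ N → ∀ m : ℕ, 1 ≤ m → m < slowDegree N →
    |(cell (slowDegree N) N m : ℝ) * Real.log N / N - cellDensity (m - 1) (slowDegree N)| ≤
      Real.exp (-((slowDegree N : ℝ) ^ 2)) / 8 * cellDensity (m - 1) (slowDegree N)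

/-! ## The shared node (proved: the two lines' cell vocabularies agree definitionally) -/

/-- The sibling line's node `NlcCellsAbsoluteClip.PrimeCellsAbsolute` (prime corner cell with ABSOLUTE error at
an `N`-dependent roughness), restated in this line's vocabulary (`ModelTransfer.jointCell`, `Negative.cell`): the
two are the same statement, because `ModelTransfer.jointCell t N u Ψ K j = NlcCellsAbsoluteClip.jointCell Ψ K N u j`
and `Negative.cell u N m = NlcCellsAbsoluteClip.roughCell N u m` hold by `rfl` and the model's product over the
constant index `1` is a `t`-th power.  So `stub_cellsToDimOne : PrimeCellsAbsolute → DimOne` is ONE stub serving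
both lines. -/
theorem primeCellsAbsolute_iff :
    NlcCellsAbsoluteClip.PrimeCellsAbsolute ↔
      ∀ (t L : ℕ), 1 ≤ t → ∀ ε : ℝ, 0 < ε → ∃ N₀ : ℕ, ∀ N : ℕ, N₀ ≤ N → ∃ u : ℕ, 2 ≤ u ∧
        ∀ Ψ : Fin t → AffLinForm 1, IsNondegenerateSystem Ψ → affLinSize Ψ N ≤ L →
          ∀ K : Set (Fin 1 → ℝ), Convex ℝ K → K ⊆ realBox 1 N →
            |(jointCell t N u Ψ K (fun _ => 1) : ℝ) -
                archFactor Ψ K * singularProduct Ψ * ((cell u N 1 : ℝ) / N) ^ t| ≤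
              ε * N / Real.log N ^ t := by
  have hcell : ∀ (t N u : ℕ) (Ψ : Fin t → AffLinForm 1) (K : Set (Fin 1 → ℝ)),
      (jointCell t N u Ψ K (fun _ => 1) : ℝ) -
          archFactor Ψ K * singularProduct Ψ * ((cell u N 1 : ℝ) / N) ^ t =
        (NlcCellsAbsoluteClip.jointCell Ψ K N u (fun _ => 1) : ℝ) -
          NlcCellsAbsoluteClip.modelCell Ψ K N u (fun _ => 1) := by
    intro t N u Ψ K
    simp only [NlcCellsAbsoluteClip.modelCell, Finset.prod_const, Finset.card_univ, Fintype.card_fin]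
    rfl
  simp only [NlcCellsAbsoluteClip.PrimeCellsAbsolute, hcell]

/-! ## The analytic input of `MarginPoly` (appended by the lead seat c1, cycle 1; nothing asserted)

The margin stub splits as `MarginPoly ⇐ ModGammaDisc` + (pencil zero-counting with the tree's complex analysis:
`Literature/Analysis/Complex/Hurwitz.lean`, `ArgumentPrincipleRectangle.lean`); `ModGammaDisc` is the one analytic
fact about the densities that is not in the tree. -/

/-- **MOD-GAMMA DISC ASYMPTOTIC of the Buchstab–Dickman row** (parity-free, pure analysis; the analytic input of
`stub_marginPoly`, type of the registered stub `stub_modGammaDisc`).  For every `K` there are `C` and `u₀` such that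
for all integers `u ≥ u₀` and all complex `|z| ≤ K + 1`,
`|Σ_{j<u} I_{j+1}(u) z^j − e^{−γz} (u−1)^z / Γ(1+z)| ≤ (C/u) · |(u−1)^z|`
(`γ` = Euler–Mascheroni; `(u−1)^z` the principal power of the positive real `u−1`, so `|(u−1)^z| = (u−1)^{Re z}`; at
`z = −1, −2, …` Mathlib's `Complex.Gamma (1+z) = 0` makes the model term `0`, the correct value of the entire function
`e^{−γz}(u−1)^z/Γ(1+z)`).  WHY: the row is `K_z(u−1)` where `v K_z'(v) = z K_z(v−1)`, `K_z ≡ 1` on `(0,1]` (the delay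
equation of `cellDensity`, tree `DensityCalculus` (C6)/(C7)); its Laplace transform is `s⁻¹ exp(z E₁(s)) =
e^{−γz} s^{−1−z} e^{z Ein(s)}` with `Ein` entire, whose only singularity is the branch point at `s = 0`: the
Hankel-loop contribution is `e^{−γz} v^z/Γ(1+z) · (1 + Σ_{k≥1} a_k(z) v^{−k})` and the rest is super-polynomially
small (de Bruijn's method for the Buchstab/Dickman equations; at `z = 1` it is `uω(u) = e^{−γ}u` + tiny).
NUMERICS (lead c1, compute/margin_gamma*.py, trapezoid step 2·10⁻³): on `|z| = 1.5, 2.5, 3.5, 4.5` the quantity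
`u · sup |F_u − M|/|v^z|` is `11.8, 294, 7.8·10³, 2.3·10⁵` at `u = 30`, stable in `u ∈ [10, 30]`; the relative error
`sup_{|z|=r} |F_u/M − 1|` decays like `1/u` (`0.085, 0.26, 0.60` at `u = 30`); real zeros of `F_u` sit at
`−1.0000, −2.0000, −3.0000, −4.0000, −5.0000` for `u ≥ 22`.  Line statement; sources for the method: de Bruijn 1951,
Alladi 1982 (Quart. J. Math. 33, acquisition acq-03831), Tenenbaum III.5–III.6. -/
def ModGammaDisc : Prop :=
  ∀ K : ℕ, ∃ C : ℝ, ∃ u₀ : ℕ, ∀ u : ℕ, u₀ ≤ u → ∀ z : ℂ, ‖z‖ ≤ (K : ℝ) + 1 →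
    ‖(∑ j ∈ Finset.range u, (cellDensity j u : ℂ) * z ^ j) -
        Complex.exp (-(Real.eulerMascheroniConstant : ℂ) * z) * (((u : ℂ) - 1) ^ z) / Complex.Gamma (1 + z)‖ ≤
      C / u * ‖((u : ℂ) - 1) ^ z‖

/-- **PENCIL CHAIN ZERO — an explicit non-real zero of the model pencil, with a clearance circle** (pure complex
analysis about `Γ`; type of the registered stub `pencil_chainZero`, the complex-analytic half of `stub_pencilDisc`).
For every `A ≥ 0` there are `C > 0` and `Λ₀ > 0` such that for all real `Λ ≥ Λ₀` and all real `τ ≠ 0` with `|τ| ≤ 2`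
and `x_τ := log|τ|/(2Λ) ≥ −A`, there is `ζ ∈ ℂ` with `3/4 < Im ζ < 5/4`, `|Re ζ − x_τ| < 1/4`, solving EXACTLY
`e^{2Λζ} Γ(1−ζ) = τ Γ(1+ζ)` (i.e. `M(ζ) + θM(−ζ) = 0` for the model row `M(z) = e^{Λz}/Γ(1+z)`, `θ = −τ`,
`Λ = log(u−1) − γ`), such that on the circle `|z − ζ| = 1/(4Λ)` one has the clearance
`|τ Γ(1+z) − e^{2Λz}Γ(1−z)| ≥ (|τ|/5)|Γ(1+z)|`, and on the closed disc `C⁻¹ ≤ |Γ(1∓z)| ≤ C`.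
PROOF PLAN (lead c1): `R(z) := Γ(1−z)/Γ(1+z)` is analytic and zero-free on the compact rectangle
`[−A−1, 3] × [1/2, 3/2]` (poles of `Γ(1±z)` lie on the real axis), so `C⁻¹ ≤ |R|, |Γ(1±z)| ≤ C` and `|R'| ≤ C` there by
compactness; put `z₁ := x_τ + i`, `ζ₀ := (Log(τ/R(z₁)) + 2πin)/(2Λ)` with `n` making `|Im ζ₀ − 1| ≤ π/(2Λ)` (then
`|ζ₀ − z₁| ≤ (log C + π)/(2Λ)`), and iterate the contraction `S(w) := Log(R(z₁)/R(ζ₀+w))/(2Λ)` on `|w| ≤ 1/(8C²)`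
(`|S'| ≤ C²/(2Λ) ≤ ½`, `|S| ≤ 1/(6Λ)`): the fixed point `w*` gives `ζ := ζ₀ + w*` with `e^{2Λζ}R(ζ) = e^{2Λζ₀}R(z₁) = τ`;
on `|δ| = 1/(4Λ)`, `e^{2Λ(ζ+δ)}R(ζ+δ) = τe^{2Λδ}(1+η)`, `|η| ≤ C²/(4Λ) ≤ 1/16`, and `|e^{w}(1+η) − 1| ≥ 0.351 − 0.103 ≥ 1/5`
for `|w| = ½`. Line statement. -/
def PencilChainZero : Prop :=
  ∀ A : ℝ, 0 ≤ A → ∃ C : ℝ, 0 < C ∧ ∃ Λ₀ : ℝ, 0 < Λ₀ ∧ ∀ Λ : ℝ, Λ₀ ≤ Λ →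
    ∀ τ : ℝ, τ ≠ 0 → |τ| ≤ 2 → -A ≤ Real.log |τ| / (2 * Λ) →
      ∃ ζ : ℂ, 3 / 4 < ζ.im ∧ ζ.im < 5 / 4 ∧ |ζ.re - Real.log |τ| / (2 * Λ)| < 1 / 4 ∧
        Complex.exp (2 * (Λ : ℂ) * ζ) * Complex.Gamma (1 - ζ) = (τ : ℂ) * Complex.Gamma (1 + ζ) ∧
        (∀ z : ℂ, ‖z - ζ‖ = 1 / (4 * Λ) →
          |τ| / 5 * ‖Complex.Gamma (1 + z)‖ ≤
            ‖(τ : ℂ) * Complex.Gamma (1 + z) - Complex.exp (2 * (Λ : ℂ) * z) * Complex.Gamma (1 - z)‖) ∧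
        (∀ z : ℂ, ‖z - ζ‖ ≤ 1 / (4 * Λ) →
          C⁻¹ ≤ ‖Complex.Gamma (1 - z)‖ ∧ ‖Complex.Gamma (1 - z)‖ ≤ C ∧
            C⁻¹ ≤ ‖Complex.Gamma (1 + z)‖ ∧ ‖Complex.Gamma (1 + z)‖ ≤ C)

end Summit.Parity.GeneralizedHardyLittlewood.Cruxes.AbsoluteUpgrade.DipMarginRateExchange

end
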